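import Literature.AlgebraicGeometry.Motives.GrassmannianQuotientIsoPullback
import Literature.AlgebraicGeometry.Motives.GrassmannianUniversalQuotientClassify
import Literature.AlgebraicGeometry.Modules.KernelOfEpiHasRank
import Literature.AlgebraicGeometry.KTheory.PullbackVectorBundle
import HarnessLib

/-!
# Sections of the universal subbundle `𝒦 = ker(𝒪^{(J)} ↠ 𝒬)` of the Grassmannian and its pull-backs

Topic `AlgebraicGeometry/Motives`; namespaces `Literature.AlgebraicGeometry.Modules` (§1–§2) and `….Motives.Grassmannian` (§3).
THEOREMS ONLY (no definition, no instance, no notation, no named fact, no `sorry`).  Seam (o1′) of the cell's (h4) (Q3) (δ)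
«the universal subbundle» (lead B-p21 (g17): ★ `Modules/KernelOfEpiHasRank` — rank `#J − k`, finite local freeness of
`𝒦 := kernel (universalQuotientπ k M b)` —; this file: its SECTIONS and PULL-BACKS):

* §1 (any `ψ : 𝒪_T^{(J)} ⟶ N`, `J` finite): `sectionsMap_freeModule_bijective` (`θ_V : Γ(T, V) ⊗ M ≅ Γ(𝒪_T^{(J)}, V)`, ★ FILE F
  `sectionsMap_freeModule_surjective` + ★ `bijective_of_surjective_of_basis`), `ker_sectionsMap_eq_comap`, and
  **`exists_linearEquiv_kernel_sections`** — `Γ(ker ψ, V) ≃ₗ ker θ_V(N, ψ ε)` compatibly with `ker ψ ↪ 𝒪^{(J)}` (sections are left exact,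
  ★ `range_appLinear_kernel_ι`);
* §2 (any epi `φ : P ↠ N`): `shortExact_kernel_of_epi`; **`exists_iso_pullback_kernel`** — `f^*(ker φ) ≅ ker (f^*φ)` when `N` is finite
  locally free (★ `KTheory.shortExact_map_pullback`: the pull-back of a locally split short exact sequence is short exact);
* §3 on `grassmannianScheme M k`: `universalQuotientπ_app_top_freeSectionOn` (`π(ε_j) = q_j`), **`ker_sectionsMap_universalQuotient`**
  (`ker θ_V = x₀|_V` on every affine `V`, ★ B-p21 G2a at ★ `universalChartData`), **`exists_linearEquiv_kernel_universalQuotientπ_sections`**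
  — `Γ(𝒦, V) ≃ₗ (x₀|_V).toSubmodule ⊆ Γ(Gr, V) ⊗ M` on affine `V` —, `shortExact_universalSubbundle`,
  **`exists_iso_pullback_kernel_universalQuotientπ`** (`f^*𝒦 ≅ ker (f^*π)`), and **`exists_linearEquiv_kernel_sections_of_pullback`** —
  for any presentation `ψ : 𝒪_T^{(J)} ⟶ f^*𝒬`, `ε_j ↦ η(q_j)` (★ FILE F), `Γ(ker ψ, V) ≃ₗ (pointsEquiv f)|_V` on affine `V ⊆ T`
  (★ FILE D kernel identity).

Consumer: F-5 (5d) «`Hilb ↪ Grass`» (the determinantal / flattening condition lives on `S₁ ⊗ 𝒦 → S_{d+1} ⊗ 𝒪`, read through the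
Fitting-ideal line ★ `Modules/LocallyFreeRankLocus*`).  [GortzWedhorn2020, (8.4) (pp. 213–215)]; [Hartshorne1977, II §5 (pp. 109–110),
II Ex. 1.8 (p. 66)]; [Fulton1998, §15.1]; [StacksProject, Tag 089R].  Cell `hodgecm-mathlib` (D-0151), count-neutral Mathlib-side capital;
nothing here is about HC — HC_CM is proved only modulo the 7 printed citations until rung 0 closes.
-/

noncomputable section
-- `TopCat.Presheaf`/`Scheme.Modules` are not reducible (as in Mathlib's `AlgebraicGeometry/Modules/Tilde.lean`).
set_option backward.isDefEq.respectTransparency false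

open CategoryTheory Opposite TensorProduct TopologicalSpace AlgebraicGeometry Limits
open Literature.AlgebraicGeometry.Motives

universe u

/-! ## §1 Sections of the kernel of a morphism out of `𝒪_T^{(J)}` -/

namespace Literature.AlgebraicGeometry.Modules

open Literature.AlgebraicGeometry.Motives.Grassmannian

variable {T : Scheme.{u}} {J : Type u} [Fintype J] {M : Type u} [AddCommGroup M] (b : Module.Basis J ℤ M)
  (N : T.Modules) (ψ : freeModule T J ⟶ N)

/-- **The sections map of the free module is bijective**: `θ_V : Γ(T, V) ⊗ M ≅ Γ(𝒪_T^{(J)}, V)`, `a ⊗ b_j ↦ a · ε_j|_V` — surjective by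
★ `sectionsMap_freeModule_surjective`, and a surjection between free modules of the same finite rank is bijective (★ `bijective_of_surjective_of_basis`;
bases `Algebra.TensorProduct.basis` and the frame ★ `freeModuleFrame`). [cite: Hartshorne1977, II §5 (p. 109)] -/
theorem sectionsMap_freeModule_bijective (V : T.Opens) :
    Function.Bijective (sectionsMap b (freeModule T J) (fun j => freeSectionOn T j ⊤) V) := by
  obtain ⟨bN⟩ := nonempty_basis_of_frame (E := freeModule T J) (freeModuleFrame T J V)
  exact bijective_of_surjective_of_basis (Algebra.TensorProduct.basis Γ(T, V) b) bN (Equiv.refl J) _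
    (sectionsMap_freeModule_surjective b V)

omit [Fintype J] in
/-- The kernel of the sections map `θ_V(N, ψ ε)` is the preimage of the sectionwise kernel of `ψ` under the bijection
`θ_V(𝒪^{(J)}, ε)` (★ `sectionsMap_app_freeSectionOn_eq`). [cite: GortzWedhorn2020, (8.4) (pp. 213–215)] -/
theorem ker_sectionsMap_eq_comap (V : T.Opens) :
    LinearMap.ker (sectionsMap b N (fun j => ψ.app ⊤ (freeSectionOn T j ⊤)) V) =
      (LinearMap.ker (appLinear ψ V)).comap (sectionsMap b (freeModule T J) (fun j => freeSectionOn T j ⊤) V) := by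
  ext z
  simp only [LinearMap.mem_ker, Submodule.mem_comap, appLinear_apply, sectionsMap_app_freeSectionOn_eq]

/-- **SECTIONS OF THE KERNEL**: for `ψ : 𝒪_T^{(J)} ⟶ N` and an open `V`, the sections `Γ(ker ψ, V)` are identified, `Γ(T, V)`-linearly and
compatibly with `kernel.ι ψ` and `θ_V(𝒪^{(J)}, ε)`, with the kernel of the sections map `θ_V(N, ψ ε) : Γ(T, V) ⊗ M → Γ(N, V)`
(sections are left exact, ★ `range_appLinear_kernel_ι`). [cite: Hartshorne1977, II Ex. 1.8 (p. 66)] [cite: GortzWedhorn2020, (8.4) (pp. 213–215)] -/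
theorem exists_linearEquiv_kernel_sections (V : T.Opens) :
    ∃ e : Γ(kernel ψ, V) ≃ₗ[Γ(T, V)] LinearMap.ker (sectionsMap b N (fun j => ψ.app ⊤ (freeSectionOn T j ⊤)) V),
      ∀ s, sectionsMap b (freeModule T J) (fun j => freeSectionOn T j ⊤) V (e s : Γ(T, V) ⊗[ℤ] M) = (kernel.ι ψ).app V s := by
  set θ := sectionsMap b (freeModule T J) (fun j => freeSectionOn T j ⊤) V with hθ
  let Θ : (Γ(T, V) ⊗[ℤ] M) ≃ₗ[Γ(T, V)] Γ(freeModule T J, V) := LinearEquiv.ofBijective θ (sectionsMap_freeModule_bijective b V)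
  have hinj : Function.Injective (appLinear (kernel.ι ψ) V) := kernel_ι_app_injective ψ V
  have hK : (LinearMap.ker (sectionsMap b N (fun j => ψ.app ⊤ (freeSectionOn T j ⊤)) V)).map (Θ : _ →ₗ[Γ(T, V)] _) =
      LinearMap.range (appLinear (kernel.ι ψ) V) := by
    rw [range_appLinear_kernel_ι, ker_sectionsMap_eq_comap]
    exact Submodule.map_comap_eq_of_surjective (sectionsMap_freeModule_bijective b V).2 _
  refine ⟨(LinearEquiv.ofInjective _ hinj).trans ((LinearEquiv.ofEq _ _ hK.symm).trans (Θ.submoduleMap _).symm), fun s => ?_⟩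
  rw [LinearEquiv.trans_apply, LinearEquiv.trans_apply, LinearEquiv.submoduleMap_symm_apply]
  change Θ (Θ.symm _) = _
  rw [LinearEquiv.apply_symm_apply, LinearEquiv.coe_ofEq_apply, LinearEquiv.ofInjective_apply, appLinear_apply]

/-! ## §2 `0 → ker ψ → P → N → 0` and its pull-backs -/

variable {P : T.Modules} (φ : P ⟶ N) [Epi φ]

/-- The kernel sequence `0 → ker φ → P → N → 0` of an epimorphism is short exact. [cite: Hartshorne1977, II Ex. 1.8 (p. 66)] -/
theorem shortExact_kernel_of_epi : (ShortComplex.mk (kernel.ι φ) φ (kernel.condition φ)).ShortExact :=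
  { exact := ShortComplex.exact_kernel φ }

/-- **Pull-back of the kernel of an epimorphism onto a finite locally free module**: `f^*(ker φ) ≅ ker (f^*φ)` compatibly with the
inclusions — the locally split sequence `0 → ker φ → P → N → 0` stays short exact under `f^*` (★ `shortExact_map_pullback`).
[cite: Fulton1998, §15.1] [cite: Hartshorne1977, II §5 (p. 110)] -/
theorem exists_iso_pullback_kernel {T' : Scheme.{u}} (f : T' ⟶ T) (hN : IsFiniteLocallyFree N) :
    ∃ e : (Scheme.Modules.pullback f).obj (kernel φ) ≅ kernel ((Scheme.Modules.pullback f).map φ),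
      e.hom ≫ kernel.ι ((Scheme.Modules.pullback f).map φ) = (Scheme.Modules.pullback f).map (kernel.ι φ) := by
  have hS := KTheory.shortExact_map_pullback f (shortExact_kernel_of_epi N φ) hN
  refine ⟨IsLimit.conePointUniqueUpToIso hS.fIsKernel (limit.isLimit (parallelPair ((Scheme.Modules.pullback f).map φ) 0)), ?_⟩
  exact IsLimit.conePointUniqueUpToIso_hom_comp hS.fIsKernel (limit.isLimit _) WalkingParallelPair.zero

end Literature.AlgebraicGeometry.Modules

/-! ## §3 The universal subbundle `𝒦 = ker (π : 𝒪_{Gr}^{(J)} ↠ 𝒬)` -/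

namespace Literature.AlgebraicGeometry.Motives.Grassmannian

open Literature.AlgebraicGeometry.Modules

variable (k : ℕ) (M : Type u) [AddCommGroup M] {J : Type u} [Fintype J] (b : Module.Basis J ℤ M)
  [(grassmannianSheaf M k).obj.IsRepresentable]

omit [Fintype J] in
/-- `π(ε_j) = q_j`: the universal quotient map sends the tautological basis section to the universal section
(★ `ChartData.quotientπ_app_freeSectionOn` at `V = ⊤`). [cite: GortzWedhorn2020, (8.4) (pp. 213–215)] -/
theorem universalQuotientπ_app_top_freeSectionOn (j : J) :
    (universalQuotientπ k M b).app ⊤ (freeSectionOn (grassmannianScheme M k) j ⊤) = universalQuotientSection k M b j := by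
  rw [universalQuotientπ, (universalChartData k M b).quotientπ_app_freeSectionOn j ⊤,
    show homOfLE (le_top : (⊤ : (grassmannianScheme M k).Opens) ≤ ⊤) = 𝟙 _ from Subsingleton.elim _ _, op_id,
    (universalQuotient k M b).presheaf.map_id]
  rfl

omit [Fintype J] in
/-- `(π(ε_j))_j = (q_j)_j` as families. [cite: GortzWedhorn2020, (8.4) (pp. 213–215)] -/
theorem universalQuotientπ_app_top_freeSectionOn_eq :
    (fun j => (universalQuotientπ k M b).app ⊤ (freeSectionOn (grassmannianScheme M k) j ⊤)) = universalQuotientSection k M b :=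
  funext (universalQuotientπ_app_top_freeSectionOn k M b)

omit [Fintype J] in
/-- **KERNEL IDENTITY FOR THE UNIVERSAL QUOTIENT ON EVERY AFFINE OPEN** (★ B-p21 `ChartData.ker_sectionsMap_quotientSection` at the
universal chart data ★ `universalChartData`): `ker (θ_V : Γ(Gr, V) ⊗ M → Γ(𝒬, V)) = x₀|_V`. [cite: GortzWedhorn2020, (8.4) (pp. 213–215)]
[cite: StacksProject, Tag 089R] -/
theorem ker_sectionsMap_universalQuotient {V : (grassmannianScheme M k).Opens} (hV : IsAffineOpen V) :
    LinearMap.ker (sectionsMap b (universalQuotient k M b) (universalQuotientSection k M b) V) =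
      (evalAffine hV (pointsEquiv M k _ (𝟙 (grassmannianScheme M k)))).toSubmodule :=
  (universalChartData k M b).ker_sectionsMap_quotientSection (exists_mem_universalChartData_U k M b) hV

/-- **SECTIONS OF THE UNIVERSAL SUBBUNDLE ARE THE UNIVERSAL SUBMODULE**: on every affine open `V ⊆ Gr`,
`Γ(𝒦, V) ≃ x₀|_V ⊆ Γ(Gr, V) ⊗ M` — the tautological rank-`k`-coquotient submodule `evalAffine V (pointsEquiv 𝟙)` — `Γ(Gr, V)`-linearly and
compatibly with `𝒦 ↪ 𝒪^{(J)}` and `θ_V(𝒪^{(J)}, ε) : Γ(V) ⊗ M ≅ Γ(𝒪^{(J)}, V)`. [cite: GortzWedhorn2020, (8.4) (pp. 213–215)] [cite: StacksProject, Tag 089R] -/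
theorem exists_linearEquiv_kernel_universalQuotientπ_sections {V : (grassmannianScheme M k).Opens} (hV : IsAffineOpen V) :
    ∃ e : Γ(kernel (universalQuotientπ k M b), V) ≃ₗ[Γ(grassmannianScheme M k, V)]
        (evalAffine hV (pointsEquiv M k _ (𝟙 (grassmannianScheme M k)))).toSubmodule,
      ∀ s, sectionsMap b (freeModule (grassmannianScheme M k) J) (fun j => freeSectionOn (grassmannianScheme M k) j ⊤) V
        (e s : Γ(grassmannianScheme M k, V) ⊗[ℤ] M) = (kernel.ι (universalQuotientπ k M b)).app V s := by
  obtain ⟨e, he⟩ := exists_linearEquiv_kernel_sections b (universalQuotient k M b) (universalQuotientπ k M b) V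
  have hK : LinearMap.ker (sectionsMap b (universalQuotient k M b)
      (fun j => (universalQuotientπ k M b).app ⊤ (freeSectionOn (grassmannianScheme M k) j ⊤)) V) =
      (evalAffine hV (pointsEquiv M k _ (𝟙 (grassmannianScheme M k)))).toSubmodule := by
    rw [universalQuotientπ_app_top_freeSectionOn_eq, ker_sectionsMap_universalQuotient]
  exact ⟨e.trans (LinearEquiv.ofEq _ _ hK), fun s => by rw [LinearEquiv.trans_apply, LinearEquiv.coe_ofEq_apply, he]⟩

omit [Fintype J] in
/-- **`0 → 𝒦 → 𝒪_{Gr}^{(J)} → 𝒬 → 0` is short exact.** [cite: GortzWedhorn2020, (8.4) (pp. 213–215)] -/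
theorem shortExact_universalSubbundle :
    (ShortComplex.mk (kernel.ι (universalQuotientπ k M b)) (universalQuotientπ k M b) (kernel.condition _)).ShortExact :=
  haveI := epi_universalQuotientπ k M b
  shortExact_kernel_of_epi (universalQuotient k M b) (universalQuotientπ k M b)

omit [Fintype J] in
/-- **PULL-BACK OF THE UNIVERSAL SUBBUNDLE**: for `f : T ⟶ grassmannianScheme M k`, `f^*𝒦 ≅ ker (f^*π)` compatibly with the inclusions into
`f^*𝒪_{Gr}^{(J)}` (the universal sequence is locally split, ★ `shortExact_map_pullback`). [cite: Fulton1998, §15.1]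
[cite: GortzWedhorn2020, (8.4) (pp. 213–215)] -/
theorem exists_iso_pullback_kernel_universalQuotientπ {T : Scheme.{u}} (f : T ⟶ grassmannianScheme M k) :
    ∃ e : (Scheme.Modules.pullback f).obj (kernel (universalQuotientπ k M b)) ≅
        kernel ((Scheme.Modules.pullback f).map (universalQuotientπ k M b)),
      e.hom ≫ kernel.ι _ = (Scheme.Modules.pullback f).map (kernel.ι (universalQuotientπ k M b)) :=
  haveI := epi_universalQuotientπ k M b
  exists_iso_pullback_kernel (universalQuotient k M b) (universalQuotientπ k M b) f
    (HasRank.isFiniteLocallyFree' (hasRank_universalQuotient k M b))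

/-- **SECTIONS OF THE PULLED-BACK SUBBUNDLE**: for `f : T ⟶ grassmannianScheme M k` and any presentation `ψ : 𝒪_T^{(J)} ⟶ f^*𝒬` with
`ψ(ε_j) = η(q_j)` (★ `exists_epi_freeModule_pullback_universalQuotient`), on every affine open `V ⊆ T`:
`Γ(ker ψ, V) ≃ (pointsEquiv f)|_V ⊆ Γ(T, V) ⊗ M` compatibly with `ker ψ ↪ 𝒪_T^{(J)}` (★ FILE D `ker_sectionsMap_pullback_universalQuotient`).
[cite: GortzWedhorn2020, (8.4) (pp. 213–215)] [cite: StacksProject, Tag 089R] -/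
theorem exists_linearEquiv_kernel_sections_of_pullback {T : Scheme.{u}} (f : T ⟶ grassmannianScheme M k)
    (ψ : freeModule T J ⟶ (Scheme.Modules.pullback f).obj (universalQuotient k M b))
    (hψ : ∀ j, ψ.app ⊤ (freeSectionOn T j ⊤) = unitSection f (universalQuotient k M b) ⊤ (universalQuotientSection k M b j))
    {V : T.Opens} (hV : IsAffineOpen V) :
    ∃ e : Γ(kernel ψ, V) ≃ₗ[Γ(T, V)] (evalAffine hV (pointsEquiv M k T f)).toSubmodule,
      ∀ s, sectionsMap b (freeModule T J) (fun j => freeSectionOn T j ⊤) V (e s : Γ(T, V) ⊗[ℤ] M) = (kernel.ι ψ).app V s := by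
  obtain ⟨e, he⟩ := exists_linearEquiv_kernel_sections b _ ψ V
  have hK : LinearMap.ker (sectionsMap b ((Scheme.Modules.pullback f).obj (universalQuotient k M b))
      (fun j => ψ.app ⊤ (freeSectionOn T j ⊤)) V) = (evalAffine hV (pointsEquiv M k T f)).toSubmodule := by
    rw [show (fun j => ψ.app ⊤ (freeSectionOn T j ⊤)) =
        fun j => unitSection f (universalQuotient k M b) ⊤ (universalQuotientSection k M b j) from funext hψ,
      ker_sectionsMap_pullback_universalQuotient k M b f hV]
  exact ⟨e.trans (LinearEquiv.ofEq _ _ hK), fun s => by rw [LinearEquiv.trans_apply, LinearEquiv.coe_ofEq_apply, he]⟩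

end Literature.AlgebraicGeometry.Motives.Grassmannian

end
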